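import Literature.MathematicalPhysics.KineticTheory.HardSphereEuler
import HarnessLib

/-!
# EnskogAdjointDuality / DualityReduction — helper 3: the EOS window

Support lemma for `Summit.AtomisticToContinuum.HydrodynamicLimit.Theses.EnskogAdjointDuality.DualityReduction`
(stmt-AtomisticToContinuum-11590). The first antecedent of `DualityReduction` is the body of the
shared support fact `HsEosLowDensity`: the hard-sphere excess free energy `f_ex` agrees on
`[0, η₀)` with a function `F` real-analytic on `(-η₀, η₀)` with `F 0 = 0`, `F'(0) = 2π/3`.
The two cruxes `CollisionResidualVanishes` and `AdjointEnskogTestFamilyR` are stated on an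
EOS WINDOW `(0, η₁)` on which `f_ex` is analytic, `f_ex' > 0` (positive contact value
`Y = (3/2π) f_ex'`) and `(η Z(η))' > 0` (isothermal stability, `Z = 1 + η f_ex'`). This file
extracts such a window: near `0`, `f_ex' = F' → 2π/3 > 0` and `(η Z)' → 1 > 0` by continuity of
the derivatives of the analytic `F`.

* `eos_window` — `∃ η₁ > 0`, `f_ex` analytic on `(0, η₁)`, `f_ex' > 0` and `(η Z)' > 0` there.

References: D. Ruelle, *Statistical Mechanics: Rigorous Results* (1969), §3.4, §4;
J. L. Lebowitz, O. Penrose, J. Math. Phys. 5 (1964) 841 (convergence of the virial expansion)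
[Ruelle1969, LebowitzPenrose1964].
-/

noncomputable section

open Set Filter Topology

namespace Summit.AtomisticToContinuum.HydrodynamicLimit.Theorems

open Literature.MathematicalPhysics.KineticTheory

/-- A function continuous at `0` with positive value at `0` is positive on a ball around `0`.
[folklore] -/
theorem exists_ball_pos_of_continuousAt {g : ℝ → ℝ} (hg : ContinuousAt g 0) (h0 : 0 < g 0) :
    ∃ δ : ℝ, 0 < δ ∧ ∀ x : ℝ, |x| < δ → 0 < g x := by
  have hev : ∀ᶠ x in 𝓝 (0 : ℝ), 0 < g x := hg.eventually (lt_mem_nhds h0)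
  obtain ⟨δ, hδ, hball⟩ := Metric.eventually_nhds_iff.1 hev
  refine ⟨δ, hδ, fun x hx => hball ?_⟩
  simpa [Real.dist_eq] using hx

/-- **The EOS window.** From the low-density equation of state (the body of `HsEosLowDensity`:
`f_ex = F` on `[0, η₀)` with `F` analytic on `(-η₀, η₀)`, `F 0 = 0`, `F'(0) = 2π/3`) there is
`η₁ > 0` such that on `(0, η₁)` the excess free energy `hsExcessFreeEnergy` is real-analytic,
`f_ex' > 0`, and `(η ↦ η Z(η))' > 0` with `Z = hsCompressibility` (near `0`:
`f_ex' = F' → 2π/3` and `(η Z)' = 1 + 2η F' + η² F'' → 1`). [cite: Ruelle1969, §3.4] -/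
theorem eos_window
    (hE : ∃ η₀ : ℝ, 0 < η₀ ∧ ∃ F : ℝ → ℝ, AnalyticOnNhd ℝ F (Set.Ioo (-η₀) η₀) ∧
      Set.EqOn hsExcessFreeEnergy F (Set.Ico 0 η₀) ∧ F 0 = 0 ∧ deriv F 0 = 2 * Real.pi / 3 ∧
      ∀ η ∈ Set.Ico 0 η₀, Filter.Tendsto
        (fun N : ℕ => -(N : ℝ)⁻¹ * Real.log (hsFreeVolume η N)) Filter.atTop (nhds (F η))) :
    ∃ η₁ : ℝ, 0 < η₁ ∧ AnalyticOnNhd ℝ hsExcessFreeEnergy (Set.Ioo 0 η₁) ∧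
      (∀ η ∈ Set.Ioo 0 η₁, 0 < deriv hsExcessFreeEnergy η) ∧
      (∀ η ∈ Set.Ioo 0 η₁, 0 < deriv (fun x : ℝ => x * hsCompressibility x) η) := by
  obtain ⟨η₀, hη₀, F, hF, hEq, -, hF'0, -⟩ := hE
  have h0mem : (0 : ℝ) ∈ Ioo (-η₀) η₀ := ⟨by linarith, hη₀⟩
  have hopen : IsOpen (Ioo (-η₀) η₀) := isOpen_Ioo
  -- `f_ex` agrees with `F` near every point of `(0, η₀)`
  have hfeq : ∀ η ∈ Ioo 0 η₀, hsExcessFreeEnergy =ᶠ[𝓝 η] F := by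
    intro η hη
    filter_upwards [isOpen_Ioo.mem_nhds hη] with x hx
    exact hEq ⟨hx.1.le, hx.2⟩
  have hderiv_eq : ∀ η ∈ Ioo 0 η₀, deriv hsExcessFreeEnergy η = deriv F η := fun η hη =>
    (hfeq η hη).deriv_eq
  -- the derivative of `F` is analytic, hence continuous, on `(-η₀, η₀)`
  have hF' : AnalyticOnNhd ℝ (deriv F) (Ioo (-η₀) η₀) := hF.deriv
  have hF'c : ContinuousAt (deriv F) 0 := (hF' 0 h0mem).continuousAt
  have hpos1 : 0 < deriv F 0 := by rw [hF'0]; positivity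
  obtain ⟨δ₁, hδ₁, hball₁⟩ := exists_ball_pos_of_continuousAt hF'c hpos1
  -- the comparison function `G η = η (1 + η F'(η))` for `η Z(η)`
  set G : ℝ → ℝ := fun x => x * (1 + x * deriv F x) with hGdef
  have hGan : AnalyticOnNhd ℝ G (Ioo (-η₀) η₀) := fun x hx =>
    analyticAt_id.mul (analyticAt_const.add (analyticAt_id.mul (hF' x hx)))
  have hG' : AnalyticOnNhd ℝ (deriv G) (Ioo (-η₀) η₀) := hGan.deriv
  have hG'c : ContinuousAt (deriv G) 0 := (hG' 0 h0mem).continuousAt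
  have hG'0 : deriv G 0 = 1 := by
    have hH : HasDerivAt (fun x : ℝ => 1 + x * deriv F x)
        (deriv (fun x : ℝ => 1 + x * deriv F x) 0) 0 :=
      ((analyticAt_const.add (analyticAt_id.mul (hF' 0 h0mem))).differentiableAt).hasDerivAt
    have hGd : deriv G 0 = 1 * (1 + 0 * deriv F 0) +
        id (0 : ℝ) * deriv (fun x : ℝ => 1 + x * deriv F x) 0 :=
      ((hasDerivAt_id (0 : ℝ)).mul hH).deriv
    rw [hGd]
    simp
  obtain ⟨δ₂, hδ₂, hball₂⟩ := exists_ball_pos_of_continuousAt hG'c (by rw [hG'0]; exact one_pos)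
  -- on `(0, η₀)` the function `η Z(η)` agrees with `G` near every point
  have hgeq : ∀ η ∈ Ioo 0 η₀, (fun x : ℝ => x * hsCompressibility x) =ᶠ[𝓝 η] G := by
    intro η hη
    filter_upwards [isOpen_Ioo.mem_nhds hη] with x hx
    simp only [hGdef, hsCompressibility, hderiv_eq x hx]
  -- the window
  refine ⟨min η₀ (min δ₁ δ₂), lt_min hη₀ (lt_min hδ₁ hδ₂), ?_, ?_, ?_⟩
  · intro η hη
    have hη' : η ∈ Ioo 0 η₀ := ⟨hη.1, hη.2.trans_le (min_le_left _ _)⟩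
    exact (hF η ⟨by linarith [hη'.1], hη'.2⟩).congr (hfeq η hη').symm
  · intro η hη
    have hη' : η ∈ Ioo 0 η₀ := ⟨hη.1, hη.2.trans_le (min_le_left _ _)⟩
    rw [hderiv_eq η hη']
    refine hball₁ η ?_
    rw [abs_of_pos hη.1]
    exact hη.2.trans_le ((min_le_right _ _).trans (min_le_left _ _))
  · intro η hη
    have hη' : η ∈ Ioo 0 η₀ := ⟨hη.1, hη.2.trans_le (min_le_left _ _)⟩
    rw [(hgeq η hη').deriv_eq]
    refine hball₂ η ?_
    rw [abs_of_pos hη.1]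
    exact hη.2.trans_le ((min_le_right _ _).trans (min_le_right _ _))

end Summit.AtomisticToContinuum.HydrodynamicLimit.Theorems

end
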